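import Summits.NavierStokesRegularity.NavierStokesRegularity.Theorems.TerminalTraceTypeITraceScarL3StripRepresentative
import Literature.Analysis.FluidPDE.ESSLocalHolderTopVanishingUniform
import HarnessLib

/-!
# The QUIET-SHELL representative of an extinct Type-I apex: smooth up to the top time with uniform
# bounds, vorticity of class `C¹ ∩ {∂ₓω ∈ C¹}` with the Carleman differential inequality, and ZERO TOP
# DATA — helper (Q3 of ROUND-26) for item `TerminalTrace.TypeITraceScarL3`
# (stmt-NavierStokesRegularity-18385), stub `stub_quietShell_noConcentration` of line `annulus-dichotomy` v4

Seat nsreg-C26-p1 (prover), `--supports stmt-NavierStokesRegularity-18385`; planner of record nsreg-p2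
g28, ROUND-26 §1c (Q3) «quiet shell ⇒ regular shell with zero top» (Tao 2021 (5.10) with `Y′ = Y″ = 0`).

* `exists_quietShell_representative` — let `(U, P)` be suitable in every `Q(a)` with plain pressure
  bound `D(z₀, r) ≤ D₀` (`z₀.1 ≤ 0`) and weakly null at the top, and QUIET on a shell slab:
  `‖U‖ ≤ K` a.e. on `]−δ, 0[ × {R < |y| < A R}`.  Then on every sub-shell slab
  `]−δ', 0[ × {R₁ < |y| < R₂}` (`0 < δ' < δ`, `R < R₁`, `R₂ < A R`) the field has a representative `V`:
  `V = U` a.e.; jointly continuous; `C^∞` slices; all spatial derivatives jointly continuous and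
  `‖Dⁿ_x V‖ ≤ K'` for `n ≤ 4` UP TO THE TOP TIME; `(V, P)` a distributional Navier–Stokes solution,
  classically divergence free; the vorticity `ω = curl V` in the class `C¹ ∩ {∂ₓω ∈ C¹}` with
  `|∂ₛω − Δω| ≤ 2K'(|ω| + |∇ω|)`; and ZERO TOP DATA: for every `θ > 0` and every compact `C` inside the
  sub-shell there is `s₀ < 0` with `|V(s, x)| ≤ θ`, `‖D_xV(s, x)‖ ≤ θ` and `|curl V(s, x)| ≤ ‖curlCLM‖ θ`
  for all `s ∈ ]s₀, 0[`, `x ∈ C`.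
  Proof: ESS's local representative (`exists_representative_of_ae_bound_of_local_pressure`, Serrin's
  quantitative interior regularity — the pressure bound is uniform by `hD`, so the constant `K'` is
  uniform up to `t = 0`), the vorticity regularity of `vorticity_c12_of_isDistributionalNSSolutionOn` /
  `vorticity_carleman_inequality`, and the upgrade of the weak top condition to uniform smallness
  `exists_uniform_small_near_top` (ESS 2003 §3 (3.25)–(3.30)) with a finite subcover.
  REMARK: the planner's typed `target_Q3_shellRegular_topZero` asked for `ContDiffOn ℝ 2 (uncurry V)`,
  i.e. `C²` in TIME of the velocity; that is not available for local suitable weak solutions (Serrin's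
  example `a(t)∇h(x)`), and the Carleman theory of the tree consumes exactly the class delivered here.

WHAT THIS IS NOT: not the Carleman half (Q2/Q4), not the stub, not item 18385, no statement about
Navier–Stokes regularity. [folklore; EscauriazaSereginSverak2003 §3 (3.25)–(3.31); Seregin2014 §6.6;
Tao2021 §5 (5.10)]
-/

noncomputable section

set_option linter.dupNamespace false

namespace Summit.NavierStokesRegularity.NavierStokesRegularity.Theorems.TypeITraceScarL3

open MeasureTheory Set Function Filter Topology TopologicalSpace Metric InnerProductSpace
open Literature.Analysis Literature.Analysis.FluidPDE
open scoped NNReal ENNReal RealInnerProductSpace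

/-- **The quiet-shell representative with zero top data** (Q3 of ROUND-26; see the module
docstring for the statement and the proof). [cite: EscauriazaSereginSverak2003, §3 (3.25)–(3.31)] -/
theorem exists_quietShell_representative
    {U : ℝ → EuclideanSpace ℝ (Fin 3) → EuclideanSpace ℝ (Fin 3)}
    {P : ℝ → EuclideanSpace ℝ (Fin 3) → ℝ}
    (hsw : ∀ a : ℝ, 0 < a →
      IsSuitableWeakSolutionInBall a (0 : ℝ × EuclideanSpace ℝ (Fin 3)) U P)
    {D₀ : ℝ≥0}
    (hD : ∀ z₀ : ℝ × EuclideanSpace ℝ (Fin 3), z₀.1 ≤ 0 → ∀ r : ℝ, 0 < r → cknD r z₀ P ≤ D₀)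
    (htop : ∀ φ : EuclideanSpace ℝ (Fin 3) → EuclideanSpace ℝ (Fin 3), ContDiff ℝ (⊤ : ℕ∞) φ →
      HasCompactSupport φ → ∀ ε : ℝ, 0 < ε →
        ∃ s₀ : ℝ, s₀ < 0 ∧ ∀ᵐ s ∂(volume.restrict (Ioo s₀ 0)), |∫ y, ⟪U s y, φ y⟫| ≤ ε)
    {δ R A K : ℝ}
    (hquiet : ∀ᵐ z ∂(volume.restrict
      (Ioo (-δ) 0 ×ˢ {y : EuclideanSpace ℝ (Fin 3) | R < ‖y‖ ∧ ‖y‖ < A * R})), ‖U z.1 z.2‖ ≤ K)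
    {δ' R₁ R₂ : ℝ} (hδ' : 0 < δ') (hδ'δ : δ' < δ) (hR₁ : R < R₁) (hR₂ : R₂ < A * R) :
    ∃ (K' : ℝ) (V : ℝ → EuclideanSpace ℝ (Fin 3) → EuclideanSpace ℝ (Fin 3)),
      uncurry V =ᵐ[volume.restrict
        (Ioo (-δ') 0 ×ˢ {y : EuclideanSpace ℝ (Fin 3) | R₁ < ‖y‖ ∧ ‖y‖ < R₂})] uncurry U ∧
      ContinuousOn (uncurry V) (Ioo (-δ') 0 ×ˢ {y : EuclideanSpace ℝ (Fin 3) | R₁ < ‖y‖ ∧ ‖y‖ < R₂}) ∧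
      (∀ z ∈ Ioo (-δ') 0 ×ˢ {y : EuclideanSpace ℝ (Fin 3) | R₁ < ‖y‖ ∧ ‖y‖ < R₂},
        ContDiffAt ℝ (⊤ : ℕ∞) (V z.1) z.2) ∧
      (∀ n : ℕ, ContinuousOn (fun z : ℝ × EuclideanSpace ℝ (Fin 3) => iteratedFDeriv ℝ n (V z.1) z.2)
        (Ioo (-δ') 0 ×ˢ {y : EuclideanSpace ℝ (Fin 3) | R₁ < ‖y‖ ∧ ‖y‖ < R₂})) ∧
      (∀ n ≤ 4, ∀ z ∈ Ioo (-δ') 0 ×ˢ {y : EuclideanSpace ℝ (Fin 3) | R₁ < ‖y‖ ∧ ‖y‖ < R₂},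
        ‖iteratedFDeriv ℝ n (V z.1) z.2‖ ≤ K') ∧
      IsDistributionalNSSolutionOn ⟨Ioo (-δ') 0 ×ˢ {y : EuclideanSpace ℝ (Fin 3) | R₁ < ‖y‖ ∧ ‖y‖ < R₂},
        isOpen_Ioo.prod (isOpen_lt continuous_const continuous_norm |>.inter
          (isOpen_lt continuous_norm continuous_const))⟩ 1 0 V P ∧
      (∀ z ∈ Ioo (-δ') 0 ×ˢ {y : EuclideanSpace ℝ (Fin 3) | R₁ < ‖y‖ ∧ ‖y‖ < R₂},
        VectorCalculus.divergence (V z.1) z.2 = 0) ∧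
      ContDiffOn ℝ 1 (uncurry (vorticity V))
        (Ioo (-δ') 0 ×ˢ {y : EuclideanSpace ℝ (Fin 3) | R₁ < ‖y‖ ∧ ‖y‖ < R₂}) ∧
      (∀ e : EuclideanSpace ℝ (Fin 3), ContDiffOn ℝ 1 (Carleman.dx e (uncurry (vorticity V)))
        (Ioo (-δ') 0 ×ˢ {y : EuclideanSpace ℝ (Fin 3) | R₁ < ‖y‖ ∧ ‖y‖ < R₂})) ∧
      (∀ z ∈ Ioo (-δ') 0 ×ˢ {y : EuclideanSpace ℝ (Fin 3) | R₁ < ‖y‖ ∧ ‖y‖ < R₂},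
        ‖Carleman.dt (uncurry (vorticity V)) z - Carleman.lap (uncurry (vorticity V)) z‖ ≤
          (K' + K') * (‖uncurry (vorticity V) z‖ +
            Real.sqrt (Carleman.gradSq (uncurry (vorticity V)) z))) ∧
      (∀ θ : ℝ, 0 < θ → ∀ C : Set (EuclideanSpace ℝ (Fin 3)), IsCompact C →
        C ⊆ {y : EuclideanSpace ℝ (Fin 3) | R₁ < ‖y‖ ∧ ‖y‖ < R₂} →
        ∃ s₀ : ℝ, s₀ < 0 ∧ -δ' ≤ s₀ ∧ ∀ s ∈ Ioo s₀ 0, ∀ x ∈ C,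
          ‖V s x‖ ≤ θ ∧ ‖fderiv ℝ (V s) x‖ ≤ θ ∧ ‖vorticity V s x‖ ≤ ‖curlCLM‖ * θ) := by
  set S' : Set (EuclideanSpace ℝ (Fin 3)) := {y | R₁ < ‖y‖ ∧ ‖y‖ < R₂} with hS'def
  set Sq : Set (EuclideanSpace ℝ (Fin 3)) := {y | R < ‖y‖ ∧ ‖y‖ < A * R} with hSqdef
  have hS'o : IsOpen S' :=
    (isOpen_lt continuous_const continuous_norm).inter (isOpen_lt continuous_norm continuous_const)
  set I : Set ℝ := Ioo (-δ') 0 with hIdef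
  have hIo : IsOpen I := isOpen_Ioo
  set Ω : Set (ℝ × EuclideanSpace ℝ (Fin 3)) := I ×ˢ S' with hΩdef
  have hΩo : IsOpen Ω := hIo.prod hS'o
  -- ### the radius `ρ` of the hanging cylinders
  set ρ : ℝ := min (1 / 2) (min ((R₁ - R) / 2) (min ((A * R - R₂) / 2) (Real.sqrt ((δ - δ') / 4))))
    with hρdef
  have hρ0 : 0 < ρ := by
    refine lt_min (by norm_num) (lt_min (by linarith) (lt_min (by linarith) (Real.sqrt_pos.2 (by linarith))))
  have hρ1 : 2 * ρ ≤ 1 := by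
    have h : ρ ≤ 1 / 2 := min_le_left _ _
    linarith
  have hρR₁ : 2 * ρ ≤ R₁ - R := by
    have h : ρ ≤ (R₁ - R) / 2 := (min_le_right _ _).trans (min_le_left _ _)
    linarith
  have hρR₂ : 2 * ρ ≤ A * R - R₂ := by
    have h : ρ ≤ (A * R - R₂) / 2 := ((min_le_right _ _).trans (min_le_right _ _)).trans (min_le_left _ _)
    linarith
  have hρδ : 4 * ρ ^ 2 ≤ δ - δ' := by
    have h : ρ ≤ Real.sqrt ((δ - δ') / 4) :=
      ((min_le_right _ _).trans (min_le_right _ _)).trans (min_le_right _ _)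
    have h2 : ρ ^ 2 ≤ (δ - δ') / 4 := by
      have := pow_le_pow_left₀ hρ0.le h 2
      rwa [Real.sq_sqrt (by linarith)] at this
    linarith
  -- ### the hypotheses of the ESS representative theorem
  have hP : ∀ z₀ : ℝ × EuclideanSpace ℝ (Fin 3), z₀.1 ≤ 0 →
      ∫⁻ q in parabolicCylinder 1 z₀, ‖P q.1 q.2‖ₑ ^ (3 / 2 : ℝ) ≤ D₀ := by
    intro z₀ hz₀
    have h := hD z₀ hz₀ 1 one_pos
    simpa [cknD] using h
  have hSS' : ∀ x ∈ S', ball x (2 * ρ) ⊆ Sq := by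
    intro x hx y hy
    rw [mem_ball, dist_eq_norm] at hy
    have h1 : ‖x‖ ≤ ‖y‖ + ‖y - x‖ := by
      calc ‖x‖ = ‖y - (y - x)‖ := by rw [sub_sub_cancel]
        _ ≤ ‖y‖ + ‖y - x‖ := norm_sub_le _ _
    have h2 : ‖y‖ ≤ ‖x‖ + ‖y - x‖ := by
      calc ‖y‖ = ‖x + (y - x)‖ := by rw [add_sub_cancel]
        _ ≤ ‖x‖ + ‖y - x‖ := norm_add_le _ _
    exact ⟨by linarith [hx.1], by linarith [hx.2]⟩
  have hbd : ∀ᵐ z ∂(volume.restrict (Ioo (-δ' - 4 * ρ ^ 2) 0 ×ˢ Sq)), ‖U z.1 z.2‖ ≤ K :=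
    ae_restrict_of_ae_restrict_of_subset (prod_mono (Ioo_subset_Ioo_left (by linarith)) Subset.rfl) hquiet
  obtain ⟨K', V, hVU, hVc, hCD, hjc, hbdK⟩ := exists_representative_of_ae_bound_of_local_pressure
    hsw hP hS'o hρ0 hρ1 le_rfl hSS' hbd
  -- ### the equations hold for the representative
  have hsolU : IsDistributionalNSSolutionOn ⟨Ω, hΩo⟩ 1 0 U P :=
    isDistributionalNSSolutionOn_of_forall_cylinder (fun a' ha' => (hsw a' ha').1.distributional)
      hΩo (prod_mono Ioo_subset_Iio_self (subset_univ _))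
  have hsol : IsDistributionalNSSolutionOn ⟨Ω, hΩo⟩ 1 0 V P :=
    hsolU.congr_ae hVU.symm (ae_of_all _ fun _ => rfl)
  have hU4 : ∀ t ∈ I, ContDiffOn ℝ 4 (V t) S' := fun t ht x hx =>
    ((hCD (t, x) ⟨ht, hx⟩).of_le (by norm_cast)).contDiffWithinAt
  have hΦ : ∀ n ≤ 4, ContinuousOn
      (fun z : ℝ × EuclideanSpace ℝ (Fin 3) => iteratedFDeriv ℝ n (V z.1) z.2) Ω := fun n _ => hjc n
  have hK₀ : ∀ z ∈ Ω, ‖V z.1 z.2‖ ≤ K' := fun z hz => by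
    have h := hbdK 0 (by norm_num) z hz
    rwa [norm_iteratedFDeriv_zero] at h
  have hK₁ : ∀ z ∈ Ω, ‖fderiv ℝ (V z.1) z.2‖ ≤ K' := fun z hz => by
    have h := hbdK 1 (by norm_num) z hz
    rwa [norm_iteratedFDeriv_one] at h
  obtain ⟨hdiv, -, -, hω1, hωx⟩ :=
    vorticity_c12_of_isDistributionalNSSolutionOn hIo hS'o hsol hU4 hΦ
  obtain ⟨-, -, hineq⟩ := vorticity_carleman_inequality hIo hS'o hsol hU4 hΦ hK₀ hK₁
  -- ### zero top data, locally uniformly, then uniformly on compact sets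
  have hloc : ∀ x₀ ∈ S', ∀ θ : ℝ, 0 < θ → ∃ s₀ ε : ℝ, s₀ < 0 ∧ -δ' ≤ s₀ ∧ 0 < ε ∧
      ∀ s ∈ Ioo s₀ 0, ∀ x ∈ ball x₀ ε, ‖V s x‖ ≤ θ ∧ ‖fderiv ℝ (V s) x‖ ≤ θ := by
    intro x₀ hx₀ θ hθ
    exact exists_uniform_small_near_top (a := -δ') (by linarith) hS'o htop hVU hVc
      (fun z hz => (hCD z hz).of_le (by norm_cast)) hK₁ (fun z hz => hbdK 2 (by norm_num) z hz) hx₀ hθ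
  refine ⟨K', V, hVU, hVc, hCD, hjc, hbdK, hsol, hdiv, hω1, hωx, hineq, ?_⟩
  intro θ hθ C hC hCS
  classical
  choose! s₀ ε hs₀ hs₀δ hε hsmall using fun x (hx : x ∈ S') => hloc x hx θ hθ
  obtain ⟨t, htC, hcov⟩ := hC.elim_nhds_subcover (fun x => ball x (ε x))
    fun x hx => ball_mem_nhds x (hε x (hCS hx))
  rcases t.eq_empty_or_nonempty with ht | ht
  · refine ⟨-δ' / 2, by linarith, by linarith, fun s _ x hx => ?_⟩
    have : x ∈ (⋃ y ∈ t, ball y (ε y)) := hcov hx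
    rw [ht] at this
    simp at this
  · obtain ⟨x₁, hx₁, hmax⟩ := t.exists_max_image (fun x => s₀ x) ht
    refine ⟨s₀ x₁, hs₀ x₁ (hCS (htC x₁ hx₁)), hs₀δ x₁ (hCS (htC x₁ hx₁)), fun s hs x hx => ?_⟩
    obtain ⟨y, hy, hxy⟩ : ∃ y ∈ t, x ∈ ball y (ε y) := by
      have h := hcov hx
      simpa only [mem_iUnion, exists_prop] using h
    have hyS : y ∈ S' := hCS (htC y hy)
    have hs' : s ∈ Ioo (s₀ y) 0 := ⟨lt_of_le_of_lt (hmax y hy) hs.1, hs.2⟩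
    obtain ⟨h1, h2⟩ := hsmall y hyS s hs' x hxy
    refine ⟨h1, h2, ?_⟩
    rw [vorticity_apply]
    exact (norm_curl_le _ _).trans (mul_le_mul_of_nonneg_left h2 (norm_nonneg curlCLM))

end Summit.NavierStokesRegularity.NavierStokesRegularity.Theorems.TypeITraceScarL3

end
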